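import Summits.MatrixMultiplication.MatrixMultiplication.Theorems.SoloInformedLopsidedLadder
import Literature.Computability.AlgebraicComplexity.RectangularExponentBounds
import HarnessLib

/-!
# `R̃(⟨3,3,2⟩) = 9 ⟹ ω ≤ 2.37` over EVERY field (the blocking bound `ω ≤ 3 − a` on a left rung)

Solo-informed seat, gen 31 (s1, fifth file).  The TRIVIAL blocking inequality `ω ≤ ω(1,a,1) + (1−a)`
(`a ≤ 1`; tree: 1-Lipschitz `omegaRect_one_one_le_add`, hypothesis-free) turns a left rung of the
lopsided ladder into an `ω`-bound with no laser-method input at all: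

* `omega_le_three_sub_of_left_rung`: `ω(1,a,1) = 2 ⟹ ω ≤ 3 − a`; `omega_le_three_sub_dualExponentAlpha`:
  `ω ≤ 3 − α`; `omega_le_three_sub_logb_of_asymptoticRank_le_sq`: `R̃(⟨n,n,2⟩) ≤ n² ⟹ ω ≤ 3 − log_n 2`.
* `omega_le_of_asymptoticRank_332_le`: **`R̃(⟨3,3,2⟩) ≤ 9 ⟹ ω ≤ 2.37`** over every field
  (`3 − log_3 2 = 2.36907… ≤ 2.37 < 2.371339`, the laser-method record) — the single statement "the
  `9 × 6 × 6` tensor `⟨3,3,2⟩` has asymptotic rank `9`" beats every known bound on `ω` by a one-line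
  argument; rung 4 gives only `ω ≤ 5/2` (`omega_le_of_asymptoticRank_442_le`).  With VWXXZ 2024 Table 1
  and convexity the value improves to `2.3378` over `ℂ` (`SoloInformedLadderTransfer.lean`).

[cite: LeGall2012, §1 (1)] [cite: LottiRomani1983, §2 (p. 174)]
-/

set_option linter.dupNamespace false

namespace Summit.MatrixMultiplication.MatrixMultiplication.Theorems

open Literature.Computability.AlgebraicComplexity

variable (K : Type) [Field K]

/-- **Blocking bound on a left rung**: `ω(1,a,1) = 2`, `a ≤ 1` ⟹ `ω ≤ 3 − a` (1-Lipschitz in `q`).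
[cite: LeGall2012, §1 (1)] -/
theorem omega_le_three_sub_of_left_rung {a : ℝ} (ha1 : a ≤ 1) (hleft : omegaRect K 1 a 1 = 2) :
    omega K ≤ 3 - a := by
  have h := omegaRect_one_one_le_add K ha1
  rw [omegaRect_one_one_one, ← omegaRect_one_mid_one, hleft] at h
  linarith

/-- **`ω ≤ 3 − α`.** [cite: LeGall2012, §1 (1)] -/
theorem omega_le_three_sub_dualExponentAlpha : omega K ≤ 3 - dualExponentAlpha K :=
  omega_le_three_sub_of_left_rung K (dualExponentAlpha_le_one K) (omegaRect_dualExponentAlpha K)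

/-- **A rung of the lopsided ladder bounds `ω`**: `R̃(⟨n,n,2⟩) ≤ n²` (`n ≥ 2`) ⟹ `ω ≤ 3 − log_n 2`.
[cite: LeGall2012, §1 (1)] -/
theorem omega_le_three_sub_logb_of_asymptoticRank_le_sq {n : ℕ} (hn : 2 ≤ n)
    (h : asymptoticRank (matMulTensor K n n 2) ≤ (n : ℝ) ^ 2) :
    omega K ≤ 3 - Real.logb n 2 := by
  have hn1 : (1 : ℝ) < n := by exact_mod_cast hn
  have hl1 : Real.logb n 2 ≤ 1 := by
    rw [Real.logb_le_iff_le_rpow hn1 (by norm_num), Real.rpow_one]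
    exact_mod_cast hn
  exact omega_le_three_sub_of_left_rung K hl1 ((asymptoticRank_lopsided_le_sq_iff_omegaRect K hn).1 h)

/-- **`R̃(⟨3,3,2⟩) ≤ 9 ⟹ ω ≤ 2.37` over every field** (`3 − log_3 2 ≤ 3 − 0.63`, as `3^63 < 2^100`);
`2.37 < 2.371339`, the laser-method record. [cite: LeGall2012, §1 (1)] -/
theorem omega_le_of_asymptoticRank_332_le (h : asymptoticRank (matMulTensor K 3 3 2) ≤ 9) :
    omega K ≤ 2.37 := by
  have h' : asymptoticRank (matMulTensor K 3 3 2) ≤ ((3 : ℕ) : ℝ) ^ 2 := by norm_num; exact h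
  have h3 := omega_le_three_sub_logb_of_asymptoticRank_le_sq K (by norm_num : 2 ≤ 3) h'
  rw [Nat.cast_ofNat] at h3
  have hl : (0.63 : ℝ) ≤ Real.logb 3 2 := by
    rw [Real.le_logb_iff_rpow_le (by norm_num) (by norm_num)]
    have e : ((3 : ℝ) ^ (0.63 : ℝ)) ^ (100 : ℕ) ≤ (2 : ℝ) ^ (100 : ℕ) := by
      rw [← Real.rpow_mul_natCast (by norm_num : (0 : ℝ) ≤ 3)]
      norm_num
    exact le_of_pow_le_pow_left₀ (by norm_num) (by positivity) e
  linarith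

/-- For contrast, **rung 4 pays nothing by blocking**: `R̃(⟨4,4,2⟩) ≤ 16 ⟹ ω ≤ 5/2` (`log_4 2 = 1/2`).
[cite: LeGall2012, §1 (1)] -/
theorem omega_le_of_asymptoticRank_442_le (h : asymptoticRank (matMulTensor K 4 4 2) ≤ 16) :
    omega K ≤ 5 / 2 := by
  have h' : asymptoticRank (matMulTensor K 4 4 2) ≤ ((4 : ℕ) : ℝ) ^ 2 := by norm_num; exact h
  have h4 := omega_le_three_sub_logb_of_asymptoticRank_le_sq K (by norm_num : 2 ≤ 4) h'
  rw [Nat.cast_ofNat] at h4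
  have hl : Real.logb 4 2 = 1 / 2 := by
    rw [show (4 : ℝ) = 2 ^ (2 : ℕ) by norm_num, Real.logb, Real.log_pow]
    have h2 : Real.log 2 ≠ 0 := Real.log_ne_zero_of_pos_of_ne_one (by norm_num) (by norm_num)
    field_simp
    ring
  rw [hl] at h4
  linarith

end Summit.MatrixMultiplication.MatrixMultiplication.Theorems
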